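import Summits.QuantumFields.YangMills.Theorems.BalabanUVNodesN15KingModelFreeRGThm31
import Summits.QuantumFields.YangMills.Theorems.BalabanUVNodesN15KingModelFreeRGThm34
import HarnessLib

/-!
# BalabanUVNodes ∕ N15 — THE KING-MODEL RUNG, FREE-FIELD EDITION (PART Τ-h, THE CHAIN): [King1986] THEOREM 2.1 (i)'s DEDUCTION RUN END TO END —
# `Thm31Printed ∧ Thm34Printed ∧ UVStable` for `kingFreeRG` (parts Τ-g, Τ-f) fed to the typer's PROVED deduction (3.10)–(3.13)
# `RGData.hasContinuumLimit_of_thm31_thm34`, giving `HasContinuumLimit (kingFreeRG …).Z` BY NAME — and the same statement proved trivially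
# (`Z ≡ 1`), displayed side by side so the content is not overstated (Track A, DAG node N15 = NE2; FAN-OUT v1.1 §N15 s3 «KING-MODEL RUNG»; regen R453 (b))

HONEST FRAMING.  Count-neutral (cell `pub-ymgap`, seat `pub-ymgap-dag-n15-e` g19; `--supports stmt-QuantumFields-27366 --as helper` = K3⁸
`SpineGivenEndpointR13SepCoPHV`).  TEMPLATE LITERATURE, `A = 0`: the typer's `King1986/ContinuumLimitStatements` types Theorems 3.1 ∕ 3.4 and the UV
stability bound as hypothesis schemas over `RGData` and PROVES King's pp. 656–657 deduction *"Hence {Z^{ε_K}(T_{ε_K}, g, h)} is a Cauchy sequence and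
converges"*; T3*/N23* cite Thm 3.4 as their template 26×, and no inhabitant of the schema existed.  THIS FILE closes PART Τ: for the free massive lattice
scalar field at `A = 0` (datum `kingFreeRG L M₀ a m² b₀ p` of part Τ-e — Lebesgue measures, (3.2)'s φ-clause, the Gaussian effective actions
`S^{(k),1} = ½⟨φ,Δ^{(k)}φ⟩ + ln 𝒩(Δ^{(k)})` on King's own `Δ^{(k)}`, `Z ≡ 1`) all three printed hypotheses hold BY NAME (`thm31Printed_kingFreeRG`,
`thm34Printed_kingFreeRG`, `uvStable_kingFreeRG`) and the deduction fires (`hasContinuumLimit_kingFreeRG`).  WHAT THIS IS AND IS NOT: the conclusion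
`HasContinuumLimit Z` is TRIVIAL for this datum (`Z^{ε_K}(T, 0, 0) ≡ 1` by King's normalisation (2.6); `hasContinuumLimit_kingFreeRG_trivial` proves it in
one line and is displayed on purpose); the CONTENT is upstream — King's Theorems 3.1 and 3.4 decided for genuine objects (Thm 3.4 through §3.6's
Prop. 3.10 route with (3.93) determinant-free; Thm 3.1 through the Gaussian large-field estimate), i.e. the schema chain is inhabited NON-VACUOUSLY and
its hypotheses are shown jointly satisfiable by a non-degenerate renormalization-group datum.  NOT the interacting U(1)-Higgs model, NOT Bałaban's
[Ba 1–4] inputs, NOT a statement with sources `g, h ≠ 0`; NOT a node discharge; nothing continuum-YM ∕ ℝ⁴ ∕ OS ∕ mass-gap ∕ Clay.  0 `sorry`, 0 `def`;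
standard axioms.  WHAT THE CURVED ∕ INTERACTING CASE ADDS (one line): `P^{(k),1} ≠ 0` — the perturbative effective action (3.14)–(3.21), its graph
bounds Thm 3.5 ∕ §3.4–3.5 (renormalization cancellations), and [Ba 1–4]'s Theorem 3.1 — none of which is in the model.
Locators: [King1986] Thm 2.1 (2.22) p.654, Thm 3.1 (3.3)–(3.4) p.655, Thm 3.4 (3.9) p.656, (3.10)–(3.13) pp.656–657, (2.6) p.652.
-/

noncomputable section

namespace Summit.QuantumFields.YangMills.BalabanUVNodes.N15KingModelRung.FreeField

open Real Filter Topology MeasureTheory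
open Literature.MathematicalPhysics.QuantumFieldTheory.King1986.ContinuumLimit (eps HasContinuumLimit RGData)

variable {d : ℕ}

section Chain

variable (L : ℕ) [NeZero L] (M₀ : ℕ) [NeZero M₀]

/-- ★★★ **THEOREM 2.1 (i)'s DEDUCTION, RUN END TO END ON THE FREE FIELD**: for `1 ≤ d ≤ 3`, `L ≥ 2`, `M₀ ≥ 1`, `a, m², b₀ > 0`, `p ≥ 1`, the sequence
`K ↦ Z^{ε_K}(T_{ε_K})` of the datum `kingFreeRG L M₀ a m² b₀ p` converges — obtained BY NAME from the typer's `RGData.hasContinuumLimit_of_thm31_thm34`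
applied to `thm31Printed_kingFreeRG`, `thm34Printed_kingFreeRG`, `uvStable_kingFreeRG` (and the side hypotheses `χ ∈ {0,1}`, finiteness).  See
`hasContinuumLimit_kingFreeRG_trivial` for why the conclusion itself carries no information here. [cite: King1986, Thm 2.1 (2.22) p.654, (3.10)–(3.13) pp.656–657] -/
theorem hasContinuumLimit_kingFreeRG (hd1 : 1 ≤ d) (hd3 : d ≤ 3) (hL : 2 ≤ L) (hM₀ : 1 ≤ M₀) {a msq b₀ p : ℝ} (ha : 0 < a) (hmsq : 0 < msq)
    (hb : 0 < b₀) (hp : 1 ≤ p) : HasContinuumLimit (kingFreeRG (d := d) L M₀ a msq b₀ p).Z :=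
  (kingFreeRG (d := d) L M₀ a msq b₀ p).hasContinuumLimit_of_thm31_thm34 (by simp [kingFreeRG]; omega) (by simpa [kingFreeRG] using hb)
    (by simpa [kingFreeRG] using hp) (by simp [kingFreeRG]) (chi_zero_or_one_kingFreeRG L M₀ a msq b₀ p) (hfin_kingFreeRG L M₀ ha hL hmsq b₀ p)
    (thm31Printed_kingFreeRG L M₀ hd1 hd3 hL hM₀ ha hmsq hb (by linarith)) (thm34Printed_kingFreeRG L M₀ hL ha hmsq hb (by linarith))
    (uvStable_kingFreeRG L M₀ a msq b₀ p)

/-- **THE SAME CONCLUSION, TRIVIALLY** — `Z^{ε_K} ≡ 1` converges to `1`.  Displayed so that no reader mistakes `hasContinuumLimit_kingFreeRG` for a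
statement about a limit that was in doubt: the content of PART Τ is the three HYPOTHESES by name, not this conclusion. [cite: King1986, (2.6) p.652] -/
theorem hasContinuumLimit_kingFreeRG_trivial (a msq b₀ p : ℝ) : HasContinuumLimit (kingFreeRG (d := d) L M₀ a msq b₀ p).Z :=
  ⟨1, by simp [kingFreeRG]⟩

/-- ★★★ **PART Τ, ONE STATEMENT**: for the free massive lattice scalar field at `A = 0` on the cubic tori `T_{ε_K}` (`1 ≤ d ≤ 3`, `L ≥ 2`, `M₀ ≥ 1`,
`a, m², b₀ > 0`, `p ≥ 1`), King's three printed hypotheses hold BY NAME on the typer's schema — THEOREM 3.1 (3.3)–(3.4), THEOREM 3.4 (3.9), the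
ULTRA-VIOLET STABILITY bound — and the printed deduction gives Theorem 2.1 (i) `HasContinuumLimit Z^{ε_K}`.
[cite: King1986, Thm 3.1 p.655, Thm 3.4 p.656, p.657, Thm 2.1 (2.22) p.654] -/
theorem king_thm21i_chain_freeField (hd1 : 1 ≤ d) (hd3 : d ≤ 3) (hL : 2 ≤ L) (hM₀ : 1 ≤ M₀) {a msq b₀ p : ℝ} (ha : 0 < a) (hmsq : 0 < msq)
    (hb : 0 < b₀) (hp : 1 ≤ p) :
    (kingFreeRG (d := d) L M₀ a msq b₀ p).Thm31Printed ∧ (kingFreeRG (d := d) L M₀ a msq b₀ p).Thm34Printed ∧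
      (kingFreeRG (d := d) L M₀ a msq b₀ p).UVStable ∧ HasContinuumLimit (kingFreeRG (d := d) L M₀ a msq b₀ p).Z :=
  ⟨thm31Printed_kingFreeRG L M₀ hd1 hd3 hL hM₀ ha hmsq hb (by linarith), thm34Printed_kingFreeRG L M₀ hL ha hmsq hb (by linarith),
    uvStable_kingFreeRG L M₀ a msq b₀ p, hasContinuumLimit_kingFreeRG L M₀ hd1 hd3 hL hM₀ ha hmsq hb hp⟩

/-- **NON-VACUITY WITNESS**: the hypotheses of `king_thm21i_chain_freeField` are jointly satisfiable — e.g. King's `d = 3`, `L = 2`, the torus with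
`M₀ = 2` sites per direction at `ε_0 = 1`, `a = m² = b₀ = p = 1`. [folklore] -/
theorem king_thm21i_chain_freeField_witness :
    (kingFreeRG (d := 3) 2 2 1 1 1 1).Thm31Printed ∧ (kingFreeRG (d := 3) 2 2 1 1 1 1).Thm34Printed ∧
      (kingFreeRG (d := 3) 2 2 1 1 1 1).UVStable ∧ HasContinuumLimit (kingFreeRG (d := 3) 2 2 1 1 1 1).Z :=
  king_thm21i_chain_freeField 2 2 (by norm_num) le_rfl le_rfl (by norm_num) one_pos one_pos one_pos le_rfl

end Chain

end Summit.QuantumFields.YangMills.BalabanUVNodes.N15KingModelRung.FreeField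

end
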